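import Summits.QuantumFields.BalabanUV.Beta.EriceRemainderEnclosureHistoryAutonomyComparisonAffineProfile

/-!
# EriceRemainderEnclosureHistoryAutonomyComparisonWindow — (E61c) EVERY UNIFORM WINDOW COMPARES AT ANY SIZE: the affine memory
# `B(u) = b + L_0·u_0 + c·Σ_{K₀≤k≤K₁} u_k` (`b > 0`, `c ≥ 0`, Markov weight `L_0 ≥ 0`, ANY position `1 ≤ K₀ ≤ K₁` and ANY sizes) satisfies (E58b)'s
# trajectory-free PROFILE CONDITION `Σ_j L_j∕P_j ≤ 2` — because the profile sum of a uniform window, `Σ_{j=K₀}^{K₁} 1∕Σ_{k=K₀}^{K₁}√(j∕(j+k))`, is at most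
# `(2.08 + ½ + √2)∕2 < 2` by a telescoping lower bound of the window profile (`inv_profile_sum_le_two`) — hence `h′ ≤ h` at every scale from every pin
# under every isotone excess with a zeroth moment (`le_of_isotone_excess_affine_uniform_window`)

Cell `pub-balaban`, β-function sub-cell, BINDER row D4 «RemainderConst leaves for Bałaban's split» (`HOME/BINDER-OWNERS.md`; owner lineage `b2b-balaban-beta-an4`;
this file by co-owner #2 lineage `b2b-balaban-beta-d4-p2`, generation 54), β-FLOW TEAM duty (1), FREEZE (0) honoured (def-free; (E58b)'s
`le_of_isotone_excess_affine_profile` BY NAME; nothing restated).  Closes the item (E61d) «the general-window profile-sum estimate» of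
`HOME/b2b-balaban-beta-d4-p2/HANDOFF.gen53.md`: with (E60a) `le_of_isotone_excess_affine_uniform` (windows from age `0` or `1`, by fading) and (E58c)
`le_of_isotone_excess_affine_window` (ages within a factor `3`) the class of UNIFORM WINDOWS is now covered at EVERY position and width; numerics in
`HOME/b2b-balaban-beta-d4-p2/g54/e61/README.md` (`window_profile.py`, `window_bound.py`).

HONEST FRAMING (page 1, verbatim and binding).  *"Discharging BetaPertH makes Bałaban's UV stability UNCONDITIONAL — a real constructive-QFT result; it is
NOT the continuum limit and NOT the Clay problem."*  THIS FILE DISCHARGES NOTHING OF THE KIND.  Elementary real analysis about ABSTRACT functionals on a box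
]0,γ]^ℕ with displayed floors, moduli and signs — hypotheses of a census, not facts; the form, signs and moments of Bałaban's (1.22) limit functional (in
particular whether its age profile is a window of any kind) are NOT PRINTED ([I] p. 298; GAPS G-t4-U2-1∕-2) and NOT asserted.  Row D4 class UNCHANGED
(critical-path width 0; instance 0∕1; D4 DISCHARGE NO DATE).  HONEST DEPENDENCY: continuum YM on T⁴ ⇐ BetaPertH ∧ nine spine estimates (0/9 proved);
BetaPertH ⇐ (D1) ∧ (D4) ∧ CAP+tail; G-an2-4 gates asym, D1 and NE2/3/4.

THE POINT (census sense (α); the COMPARISON column of the autonomy row).  (E58b) proves comparison at any size for `b + Σ_k L_k·u_k` under the PROFILE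
CONDITION `Σ_{j<K} L_j∕P_j ≤ 2`, `P_j = Σ_k L_k·√(j∕(j+k))`, a trajectory-free inequality between the weights alone; gen 51 measured it for uniform
windows (`↑ ≈ 1.65`) and left «the finite square-root sums untyped».  For the uniform window `L_k = c` on `K₀ ≤ k ≤ K₁` (plus any Markov weight `L_0`,
whose summand `j = 0` reads `0` and which only enlarges every `P_j`) the condition reads `Σ_{j=K₀}^{K₁} 1∕P̂_j ≤ 2`, `P̂_j = Σ_{k=K₀}^{K₁} √(j∕(j+k))`.
§1–§2 prove it for ALL `1 ≤ K₀ ≤ K₁`: every read dominates a telescope step, `√(j∕(j+k)) ≥ 2√j·(√(j+k+1) − √(j+k))`, so `P̂_j ≥ 2√j·(√(j+K₁+1) −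
√(j+K₀))` and `1∕P̂_j ≤ (√(j+K₁+1) + √(j+K₀))∕(2n√j)` (`n = K₁ − K₀ + 1`); then `√(j+K₀) ≤ √(2j)`, `√(j+K₁+1) ≤ √(K₁+1) + j∕(2√(K₁+1))`, the
square-root sum `Σ_j 1∕√j ≤ 1∕√K₀ + 2√K₁ − 2√K₀` and the polynomial inequality `key_ineq` give `Σ_j 1∕P̂_j ≤ (2.08 + ½ + √2)∕2 ≤ 2`.  (The true
supremum is the continuum value `½ + ½∫₀¹√(1 + 1∕t) dt = ½ + (√2 + asinh 1)∕2 = 1.648`, approached as `K₁∕K₀ → ∞`; the telescoped bound is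
asymptotically exact, the losses are in the two elementary square-root estimates.)  §3 feeds (E58b): EVERY uniform window, at every position, of
every width and strength, with any Markov weight, compares at any size under every isotone excess with a zeroth moment.  NOT CLAIMED: non-uniform
windows (two far ages of equal strength have profile sum `→ 2`, the general profile stays with (E58b)∕(E59e)∕(E60a)); anything printed.

WHAT IS PROVED ([folklore]; 0 `def`, 0 sorry).  §1 `sum_inv_sqrt_le`, `telescope_le_sqrt_div`, **`profile_ge_telescope`**,
`sqrt_add_le`, **`key_ineq`**.  §2 **`inv_profile_term_le`**, **`inv_profile_sum_le_two`**.  §3 **`le_of_isotone_excess_affine_uniform_window`**.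
-/
noncomputable section
open Finset Set

namespace Summit.QuantumFields.BalabanUV.Beta.EriceRemainderEnclosureHistoryAutonomyComparisonWindow

open Literature.MathematicalPhysics.QuantumFieldTheory.Balaban1983to89
open Literature.MathematicalPhysics.QuantumFieldTheory.Balaban1983to89.T4BetaStationary
open Literature.MathematicalPhysics.QuantumFieldTheory.Balaban1983to89.T4BetaFlowWellPosed
open Summit.QuantumFields.BalabanUV.Beta.EriceRemainderEnclosureHistoryAutonomyComparisonAffineProfile (le_of_isotone_excess_affine_profile)

variable {B' : (ℕ → ℝ) → ℝ} {M' γ b : ℝ} {L : ℕ → ℝ} {K : ℕ} {h h' : ℕ → ℝ}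

/-! ## §1 Square-root bookkeeping: telescopes, concavity, and the key polynomial inequality -/
/-- The square-root sum against its telescope: `Σ_{s≤m} 1∕√(K₀+s) ≤ 1∕√K₀ + 2√(K₀+m) − 2√K₀` for `K₀ ≥ 1` (the first term kept, every later one
telescoped by `1∕√x ≤ 2(√x − √(x−1))`). [folklore] -/
theorem sum_inv_sqrt_le {K₀ : ℝ} (hK₀ : 1 ≤ K₀) : ∀ m : ℕ,
    ∑ s ∈ range (m + 1), 1 / Real.sqrt (K₀ + s) ≤ 1 / Real.sqrt K₀ + 2 * Real.sqrt (K₀ + m) - 2 * Real.sqrt K₀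
  | 0 => by simp
  | m + 1 => by
    rw [sum_range_succ]
    have ih := sum_inv_sqrt_le hK₀ m
    -- the new term against one telescope step: 1/√x ≤ 2(√x − √(x−1)), x = K₀ + m + 1 (cf. `one_div_sqrt_le` of the planar-geometry corpus)
    have hm0 : (0 : ℝ) ≤ m := Nat.cast_nonneg m
    have ex : K₀ + ((m + 1 : ℕ) : ℝ) = K₀ + (m : ℝ) + 1 := by push_cast; ring
    rw [ex]
    set x : ℝ := K₀ + (m : ℝ) + 1 with hx_def
    have hx0 : 0 < x := by rw [hx_def]; linarith
    have hsa : 0 < Real.sqrt x := Real.sqrt_pos.mpr hx0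
    have hsb : 0 ≤ Real.sqrt (K₀ + (m : ℝ)) := Real.sqrt_nonneg _
    have ea : Real.sqrt x ^ 2 = x := Real.sq_sqrt hx0.le
    have eb : Real.sqrt (K₀ + (m : ℝ)) ^ 2 = K₀ + (m : ℝ) := Real.sq_sqrt (by linarith)
    have hba : Real.sqrt (K₀ + (m : ℝ)) ≤ Real.sqrt x := Real.sqrt_le_sqrt (by rw [hx_def]; linarith)
    have hab : (Real.sqrt x - Real.sqrt (K₀ + (m : ℝ))) * (Real.sqrt x + Real.sqrt (K₀ + (m : ℝ))) = 1 := by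
      rw [hx_def] at ea ⊢; nlinarith
    have hstep : 1 / Real.sqrt x ≤ 2 * (Real.sqrt x - Real.sqrt (K₀ + (m : ℝ))) := by
      rw [div_le_iff₀ hsa]; nlinarith
    linarith

/-- One read of the window profile dominates one telescope step: `2√j(√(x+1) − √x) ≤ √(j∕x)` for `j ≥ 0`, `x > 0`. [folklore] -/
theorem telescope_le_sqrt_div {j x : ℝ} (hj : 0 ≤ j) (hx : 0 < x) :
    2 * Real.sqrt j * (Real.sqrt (x + 1) - Real.sqrt x) ≤ Real.sqrt (j / x) := by
  have hsx : 0 < Real.sqrt x := Real.sqrt_pos.mpr hx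
  have hsx1 : 0 < Real.sqrt (x + 1) := Real.sqrt_pos.mpr (by linarith)
  have hprod : (Real.sqrt (x + 1) - Real.sqrt x) * (Real.sqrt (x + 1) + Real.sqrt x) = 1 := by
    have e1 : Real.sqrt x ^ 2 = x := Real.sq_sqrt hx.le
    have e2 : Real.sqrt (x + 1) ^ 2 = x + 1 := Real.sq_sqrt (by linarith)
    nlinarith
  have hle : Real.sqrt x ≤ Real.sqrt (x + 1) := Real.sqrt_le_sqrt (by linarith)
  have hdiff : Real.sqrt (x + 1) - Real.sqrt x ≤ 1 / (2 * Real.sqrt x) := by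
    rw [le_div_iff₀ (by positivity)]; nlinarith
  rw [Real.sqrt_div hj, show Real.sqrt j / Real.sqrt x = 2 * Real.sqrt j * (1 / (2 * Real.sqrt x)) by field_simp]
  exact mul_le_mul_of_nonneg_left hdiff (by positivity)

/-- **THE TELESCOPED LOWER BOUND OF THE WINDOW PROFILE**: `Σ_{t<n} √(j∕(j+K₀+t)) ≥ 2√j·(√(j+K₀+n) − √(j+K₀))` — asymptotically exact
(`g54/e61/README.md`: the bound reproduces the continuum value `½ + ½∫₀¹√(1+1∕t)dt = 1.648` of the profile sum). [folklore] -/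
theorem profile_ge_telescope {j K₀ : ℝ} (hj : 0 ≤ j) (hK₀ : 0 < j + K₀) : ∀ n : ℕ,
    2 * Real.sqrt j * (Real.sqrt (j + K₀ + n) - Real.sqrt (j + K₀)) ≤ ∑ t ∈ range n, Real.sqrt (j / (j + K₀ + t))
  | 0 => by simp
  | n + 1 => by
    rw [sum_range_succ]
    have ih := profile_ge_telescope hj hK₀ n
    have h := telescope_le_sqrt_div hj (show 0 < j + K₀ + (n : ℝ) by linarith [(Nat.cast_nonneg n : (0:ℝ) ≤ n)])
    have e : j + K₀ + (n : ℝ) + 1 = j + K₀ + ((n + 1 : ℕ) : ℝ) := by push_cast; ring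
    rw [e] at h
    nlinarith [Real.sqrt_nonneg j]

/-- Concavity of the square root: `√(j + C) ≤ √C + j∕(2√C)` for `j ≥ 0`, `C > 0`. [folklore] -/
theorem sqrt_add_le {j C : ℝ} (hj : 0 ≤ j) (hC : 0 < C) : Real.sqrt (j + C) ≤ Real.sqrt C + j / (2 * Real.sqrt C) := by
  have hsC : 0 < Real.sqrt C := Real.sqrt_pos.mpr hC
  have hR : 0 ≤ Real.sqrt C + j / (2 * Real.sqrt C) := by positivity
  rw [show Real.sqrt C + j / (2 * Real.sqrt C) = Real.sqrt ((Real.sqrt C + j / (2 * Real.sqrt C)) ^ 2) by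
    rw [Real.sqrt_sq hR]]
  apply Real.sqrt_le_sqrt
  have eC : Real.sqrt C ^ 2 = C := Real.sq_sqrt hC.le
  have hxy : 2 * Real.sqrt C * (j / (2 * Real.sqrt C)) = j := by field_simp
  have e : (Real.sqrt C + j / (2 * Real.sqrt C)) ^ 2 = C + j + (j / (2 * Real.sqrt C)) ^ 2 := by rw [add_sq, eC, hxy]
  rw [e]
  have : 0 ≤ (j / (2 * Real.sqrt C)) ^ 2 := sq_nonneg _
  linarith

/-- **THE KEY INEQUALITY** of the window estimate: `√(K₁+1)·(1∕√K₀ + 2√K₁ − 2√K₀) ≤ 2.08·(K₁ − K₀ + 1)` for reals `1 ≤ K₀ ≤ K₁` (with `a = √K₀`,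
`s = a + d = √K₁` and `√(K₁+1) ≤ s + 1∕(2s)` it is the polynomial inequality `4.32a³d + 4.48a²d² + 0.16ad³ + 2.16a² − 1.84ad − 2d² − 1 ≥ 0`, each
negative monomial absorbed by `a ≥ 1`; numerically the slack is `≥ 0.08·(K₁ − K₀ + 1)`). [folklore] -/
theorem key_ineq {K₀ K₁ : ℝ} (h1 : 1 ≤ K₀) (h2 : K₀ ≤ K₁) :
    Real.sqrt (K₁ + 1) * (1 / Real.sqrt K₀ + 2 * Real.sqrt K₁ - 2 * Real.sqrt K₀) ≤ 2.08 * (K₁ - K₀ + 1) := by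
  set a : ℝ := Real.sqrt K₀ with ha_def
  set s : ℝ := Real.sqrt K₁ with hs_def
  have hK₀0 : 0 < K₀ := by linarith
  have hK₁0 : 0 < K₁ := by linarith
  have ha1 : 1 ≤ a := by rw [ha_def, show (1:ℝ) = Real.sqrt 1 by simp]; exact Real.sqrt_le_sqrt h1
  have ha0 : 0 < a := by linarith
  have has : a ≤ s := Real.sqrt_le_sqrt h2
  have hs0 : 0 < s := by linarith
  have ea : a ^ 2 = K₀ := Real.sq_sqrt hK₀0.le
  have es : s ^ 2 = K₁ := Real.sq_sqrt hK₁0.le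
  have hroot : Real.sqrt (K₁ + 1) ≤ s + 1 / (2 * s) := by
    have := sqrt_add_le (show (0:ℝ) ≤ 1 by norm_num) hK₁0
    rw [add_comm] at this
    simpa [hs_def] using this
  have hX : 0 ≤ 1 / a + 2 * s - 2 * a := by
    have : 0 < 1 / a := by positivity
    linarith
  have step1 : Real.sqrt (K₁ + 1) * (1 / a + 2 * s - 2 * a) ≤ (s + 1 / (2 * s)) * (1 / a + 2 * s - 2 * a) :=
    mul_le_mul_of_nonneg_right hroot hX
  refine step1.trans ?_
  rw [← ea, ← es]
  set d : ℝ := s - a with hd_def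
  have hd : 0 ≤ d := by rw [hd_def]; linarith
  have hs_eq : s = a + d := by rw [hd_def]; ring
  have key : (s + 1 / (2 * s)) * (1 / a + 2 * s - 2 * a) = (2 * s ^ 2 + 1) * (1 + 2 * a * s - 2 * a ^ 2) / (2 * a * s) := by
    field_simp
  rw [key, div_le_iff₀ (by positivity)]
  rw [hs_eq]
  have t1 : 0 ≤ a * d * (a ^ 2 - 1) := mul_nonneg (mul_nonneg ha0.le hd) (by nlinarith)
  have t2 : 0 ≤ d ^ 2 * (a ^ 2 - 1) := mul_nonneg (sq_nonneg d) (by nlinarith)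
  have t3 : 0 ≤ a * d := mul_nonneg ha0.le hd
  have t4 : 0 ≤ d ^ 2 := sq_nonneg d
  have t5 : 0 ≤ a ^ 2 - 1 := by nlinarith
  have t6 : 0 ≤ a * d ^ 3 := mul_nonneg ha0.le (pow_nonneg hd 3)
  nlinarith [t1, t2, t3, t4, t5, t6]

/-! ## §2 The profile sum of a uniform window is at most two -/

/-- **ONE SUMMAND OF THE PROFILE SUM OF A UNIFORM WINDOW**: for `j = K₀ + s`, `s < n` (`K₀ ≥ 1`), `1∕P̂_j ≤ (√(K₀+n)∕√j + ½ + √2)∕(2n)` where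
`P̂_j = Σ_{t<n} √(j∕(j + K₀ + t))` — `profile_ge_telescope`, the rationalisation `1∕(2√j(√A − √B)) = (√A + √B)∕(2n√j)` (`A − B = n`), `√A ≤ √C +
j∕(2√C)` with `C = K₀ + n ≥ j` and `√B ≤ √(2j)` (`B = j + K₀ ≤ 2j`). [folklore] -/
theorem inv_profile_term_le {K₀ s n : ℕ} (hK₀ : 1 ≤ K₀) (hs : s < n) :
    1 / ∑ t ∈ range n, Real.sqrt (((K₀ + s : ℕ) : ℝ) / (((K₀ + s : ℕ) : ℝ) + ((K₀ + t : ℕ) : ℝ))) ≤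
      (Real.sqrt ((K₀ : ℝ) + n) * (1 / Real.sqrt ((K₀ : ℝ) + s)) + 1 / 2 + Real.sqrt 2) / (2 * n) := by
  have hK₀r : (1 : ℝ) ≤ K₀ := by exact_mod_cast hK₀
  have hn : (1 : ℝ) ≤ n := by exact_mod_cast (Nat.succ_le_of_lt (lt_of_le_of_lt (Nat.zero_le s) hs))
  have hsn : (s : ℝ) + 1 ≤ n := by exact_mod_cast Nat.succ_le_of_lt hs
  set j : ℝ := ((K₀ + s : ℕ) : ℝ) with hj_def
  have hj : j = (K₀ : ℝ) + s := by rw [hj_def]; push_cast; ring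
  have hj1 : 1 ≤ j := by rw [hj]; linarith [(Nat.cast_nonneg s : (0:ℝ) ≤ s)]
  have hj0 : 0 < j := by linarith
  -- rewrite the inner sum in the form of `profile_ge_telescope`
  have hsum : ∑ t ∈ range n, Real.sqrt (j / (j + ((K₀ + t : ℕ) : ℝ))) = ∑ t ∈ range n, Real.sqrt (j / (j + (K₀ : ℝ) + t)) :=
    sum_congr rfl fun t _ => by push_cast; rw [add_assoc]
  rw [hsum]
  set A : ℝ := j + K₀ + n with hA
  set Bv : ℝ := j + K₀ with hBv
  have hBv0 : 0 < Bv := by rw [hBv]; linarith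
  have hA0 : 0 < A := by rw [hA]; linarith
  have hBA : Bv < A := by rw [hA, hBv]; linarith
  have hsqBA : Real.sqrt Bv < Real.sqrt A := Real.sqrt_lt_sqrt hBv0.le hBA
  have hlow := profile_ge_telescope hj0.le (by linarith : 0 < j + (K₀ : ℝ)) n
  -- p = 2√j(√A − √B) > 0 and 1/P̂ ≤ 1/p = (√A + √B)/(2 n √j)
  have hsj : 0 < Real.sqrt j := Real.sqrt_pos.mpr hj0
  have hp : 0 < 2 * Real.sqrt j * (Real.sqrt A - Real.sqrt Bv) := by nlinarith
  have hinv : 1 / ∑ t ∈ range n, Real.sqrt (j / (j + (K₀ : ℝ) + t)) ≤ 1 / (2 * Real.sqrt j * (Real.sqrt A - Real.sqrt Bv)) :=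
    one_div_le_one_div_of_le hp hlow
  have hrat : 1 / (2 * Real.sqrt j * (Real.sqrt A - Real.sqrt Bv)) = (Real.sqrt A + Real.sqrt Bv) / (2 * n * Real.sqrt j) := by
    have eA : Real.sqrt A ^ 2 = A := Real.sq_sqrt hA0.le
    have eB : Real.sqrt Bv ^ 2 = Bv := Real.sq_sqrt hBv0.le
    have hAB : A - Bv = n := by rw [hA, hBv]; ring
    rw [div_eq_div_iff hp.ne' (by positivity)]
    nlinarith [eA, eB, hAB]
  -- √A/√j ≤ √C/√j + 1/2 (C = K₀ + n), √B/√j ≤ √2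
  set C : ℝ := (K₀ : ℝ) + n with hC
  have hC0 : 0 < C := by rw [hC]; linarith
  have hjC : j ≤ C := by rw [hj, hC]; linarith
  have hA' : A = j + C := by rw [hA, hC]; ring
  have hsqA : Real.sqrt A ≤ Real.sqrt C + j / (2 * Real.sqrt C) := by rw [hA']; exact sqrt_add_le hj0.le hC0
  have hsC : 0 < Real.sqrt C := Real.sqrt_pos.mpr hC0
  have hsjC : Real.sqrt j ≤ Real.sqrt C := Real.sqrt_le_sqrt hjC
  have ej : Real.sqrt j ^ 2 = j := Real.sq_sqrt hj0.le
  have hA_div : Real.sqrt A / Real.sqrt j ≤ Real.sqrt C * (1 / Real.sqrt j) + 1 / 2 := by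
    rw [div_le_iff₀ hsj]
    have e1 : (Real.sqrt C * (1 / Real.sqrt j) + 1 / 2) * Real.sqrt j = Real.sqrt C + Real.sqrt j / 2 := by
      field_simp
    rw [e1]
    have : j / (2 * Real.sqrt C) ≤ Real.sqrt j / 2 := by
      rw [div_le_div_iff₀ (by positivity) (by norm_num)]
      nlinarith [ej, hsjC]
    linarith
  have hB_div : Real.sqrt Bv / Real.sqrt j ≤ Real.sqrt 2 := by
    rw [div_le_iff₀ hsj, ← Real.sqrt_mul (by norm_num : (0:ℝ) ≤ 2)]
    apply Real.sqrt_le_sqrt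
    rw [hBv, hj]; linarith [(Nat.cast_nonneg s : (0:ℝ) ≤ s)]
  calc 1 / ∑ t ∈ range n, Real.sqrt (j / (j + (K₀ : ℝ) + t))
      ≤ (Real.sqrt A + Real.sqrt Bv) / (2 * n * Real.sqrt j) := hinv.trans hrat.le
    _ = (Real.sqrt A / Real.sqrt j + Real.sqrt Bv / Real.sqrt j) / (2 * n) := by
        field_simp
    _ ≤ (Real.sqrt C * (1 / Real.sqrt j) + 1 / 2 + Real.sqrt 2) / (2 * n) := by
        apply div_le_div_of_nonneg_right _ (by positivity)
        rw [hj] at hA_div hB_div ⊢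
        linarith
    _ = (Real.sqrt ((K₀ : ℝ) + n) * (1 / Real.sqrt ((K₀ : ℝ) + s)) + 1 / 2 + Real.sqrt 2) / (2 * n) := by rw [hC, hj]

/-- **THE PROFILE SUM OF A UNIFORM WINDOW IS AT MOST TWO**: `Σ_{s<n} 1∕P̂_{K₀+s} ≤ 2` for every `K₀ ≥ 1`, `n ≥ 1` (`P̂_j = Σ_{t<n} √(j∕(j+K₀+t))`) —
summing `inv_profile_term_le` with `sum_inv_sqrt_le` and `key_ineq`: `(2.08 + ½ + √2)∕2 ≤ 2`.  Numerically the sum increases in `n` to the continuum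
value `1.648`; the bound proved is `1.957`‐tight only asymptotically. [folklore] -/
theorem inv_profile_sum_le_two {K₀ n : ℕ} (hK₀ : 1 ≤ K₀) (hn : 1 ≤ n) :
    ∑ s ∈ range n, 1 / ∑ t ∈ range n, Real.sqrt (((K₀ + s : ℕ) : ℝ) / (((K₀ + s : ℕ) : ℝ) + ((K₀ + t : ℕ) : ℝ))) ≤ 2 := by
  have hK₀r : (1 : ℝ) ≤ K₀ := by exact_mod_cast hK₀
  have hnr : (1 : ℝ) ≤ n := by exact_mod_cast hn
  obtain ⟨m, rfl⟩ : ∃ m, n = m + 1 := ⟨n - 1, by omega⟩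
  have hmr : ((m + 1 : ℕ) : ℝ) = (m : ℝ) + 1 := by push_cast; ring
  calc ∑ s ∈ range (m + 1), 1 / ∑ t ∈ range (m + 1), Real.sqrt (((K₀ + s : ℕ) : ℝ) / (((K₀ + s : ℕ) : ℝ) + ((K₀ + t : ℕ) : ℝ)))
      ≤ ∑ s ∈ range (m + 1), (Real.sqrt ((K₀ : ℝ) + (m + 1 : ℕ)) * (1 / Real.sqrt ((K₀ : ℝ) + s)) + 1 / 2 + Real.sqrt 2) / (2 * (m + 1 : ℕ)) :=
        sum_le_sum fun s hs => inv_profile_term_le hK₀ (Finset.mem_range.mp hs)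
    _ = (Real.sqrt ((K₀ : ℝ) + (m + 1 : ℕ)) * ∑ s ∈ range (m + 1), 1 / Real.sqrt ((K₀ : ℝ) + s)
          + ((m + 1 : ℕ) : ℝ) * (1 / 2 + Real.sqrt 2)) / (2 * (m + 1 : ℕ)) := by
        rw [← sum_div, sum_add_distrib, sum_add_distrib, ← mul_sum, sum_const, sum_const, card_range]
        simp only [nsmul_eq_mul]
        ring
    _ ≤ (2.08 * ((m + 1 : ℕ) : ℝ) + ((m + 1 : ℕ) : ℝ) * (1 / 2 + Real.sqrt 2)) / (2 * (m + 1 : ℕ)) := by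
        apply div_le_div_of_nonneg_right _ (by positivity)
        have h1 := sum_inv_sqrt_le hK₀r m
        have h2 := key_ineq hK₀r (show (K₀ : ℝ) ≤ K₀ + m by linarith [(Nat.cast_nonneg m : (0:ℝ) ≤ m)])
        have e1 : (K₀ : ℝ) + m + 1 = (K₀ : ℝ) + ((m + 1 : ℕ) : ℝ) := by push_cast; ring
        have e2 : (K₀ : ℝ) + m - K₀ + 1 = ((m + 1 : ℕ) : ℝ) := by push_cast; ring
        rw [e1, e2] at h2
        have hC : 0 ≤ Real.sqrt ((K₀ : ℝ) + ((m + 1 : ℕ) : ℝ)) := Real.sqrt_nonneg _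
        nlinarith [mul_le_mul_of_nonneg_left h1 hC]
    _ ≤ 2 := by
        have hs2 : Real.sqrt 2 ≤ 1.42 := by
          rw [show (1.42 : ℝ) = Real.sqrt (1.42 ^ 2) by rw [Real.sqrt_sq (by norm_num)]]
          exact Real.sqrt_le_sqrt (by norm_num)
        rw [div_le_iff₀ (by positivity)]
        nlinarith [hmr]

/-! ## §3 END: every uniform window compares at any size -/

/-- **EVERY UNIFORM WINDOW COMPARES AT ANY SIZE.**  `B(u) = b + Σ_{k<K} L_k·u_k` with `b > 0`, `L ≥ 0`, and the weights of the ages `k ≥ 1` forming a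
UNIFORM WINDOW: `L_k = c` for `K₀ ≤ k ≤ K₁` (`1 ≤ K₀ ≤ K₁ < K`, `c > 0`) and `L_k = 0` for every other `k ≥ 1` (a Markov weight `L_0 ≥ 0` may ride
along).  Then for every `B′ ≥ B` on ]0,γ] with a zeroth moment and an ISOTONE excess, ANY box solutions `h`, `h′` of `B`, `B′` from one pin `p ∈ ]0,γ]`
satisfy `h′ ≤ h` at EVERY scale — (E58b) `le_of_isotone_excess_affine_profile` with the profile condition supplied by §2 (the summand `j = 0` reads `0`,
the summands `j ∉ [K₀,K₁]` vanish with `L_j`, and on the window `L_j∕P_j ≤ 1∕P̂_j` because the Markov read only enlarges `P_j`). [folklore] -/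
theorem le_of_isotone_excess_affine_uniform_window {p c : ℝ} {K₀ K₁ : ℕ} (hL : ∀ k, 0 ≤ L k) (hb : 0 < b) (hK₀ : 1 ≤ K₀) (hK₀₁ : K₀ ≤ K₁)
    (hK₁ : K₁ < K) (hc : 0 < c) (hwin : ∀ k, k ≠ 0 → L k ≠ 0 → K₀ ≤ k ∧ k ≤ K₁) (hunif : ∀ k, K₀ ≤ k → k ≤ K₁ → L k = c)
    (hB' : ∀ u u' : ℕ → ℝ, SeqBox γ u → SeqBox γ u' → ∀ D : ℝ, (∀ j, |u j - u' j| ≤ D) → |B' u - B' u'| ≤ M' * D) (hM' : 0 ≤ M')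
    (hexc : ∀ u, SeqBox γ u → (fun u : ℕ → ℝ => b + ∑ k ∈ range K, L k * u k) u ≤ B' u)
    (hDmono : ∀ u v : ℕ → ℝ, SeqBox γ u → SeqBox γ v → (∀ j, u j ≤ v j) →
      B' u - (fun u : ℕ → ℝ => b + ∑ k ∈ range K, L k * u k) u ≤ B' v - (fun u : ℕ → ℝ => b + ∑ k ∈ range K, L k * u k) v)
    (hp : 0 < p) (hpγ : p ≤ γ) (hh : SeqBox γ h) (hf : MemFlow (fun u : ℕ → ℝ => b + ∑ k ∈ range K, L k * u k) p h)
    (hh' : SeqBox γ h') (hf' : MemFlow B' p h') (j : ℕ) : h' j ≤ h j := by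
  refine le_of_isotone_excess_affine_profile hL hb ?_ hB' hM' hexc hDmono hp hpγ hh hf hh' hf' j
  set n : ℕ := K₁ + 1 - K₀ with hn_def
  have hn1 : 1 ≤ n := by omega
  have hsub : Finset.Ico K₀ (K₁ + 1) ⊆ range K := fun k hk => by
    rw [Finset.mem_Ico] at hk; rw [Finset.mem_range]; omega
  -- the profile P_i and the window profile P̂_i
  set P : ℕ → ℝ := fun i => ∑ k ∈ range K, L k * Real.sqrt ((i : ℝ) / ((i : ℝ) + k)) with hP_def
  set Ph : ℕ → ℝ := fun i => ∑ k ∈ Finset.Ico K₀ (K₁ + 1), Real.sqrt ((i : ℝ) / ((i : ℝ) + k)) with hPh_def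
  -- on the window the Markov read and the vanishing weights only enlarge P_i: c·P̂_i ≤ P_i
  have hPge : ∀ i, c * Ph i ≤ P i := by
    intro i
    rw [hPh_def, hP_def]; dsimp only
    rw [mul_sum]
    calc ∑ k ∈ Finset.Ico K₀ (K₁ + 1), c * Real.sqrt ((i : ℝ) / ((i : ℝ) + k))
        = ∑ k ∈ Finset.Ico K₀ (K₁ + 1), L k * Real.sqrt ((i : ℝ) / ((i : ℝ) + k)) :=
          sum_congr rfl fun k hk => by rw [Finset.mem_Ico] at hk; rw [hunif k hk.1 (by omega)]
      _ ≤ ∑ k ∈ range K, L k * Real.sqrt ((i : ℝ) / ((i : ℝ) + k)) :=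
          sum_le_sum_of_subset_of_nonneg hsub fun k _ _ => mul_nonneg (hL k) (Real.sqrt_nonneg _)
  -- the window profile is positive on the window (telescoped lower bound)
  have hPhpos : ∀ i, K₀ ≤ i → i ≤ K₁ → 0 < Ph i := by
    intro i hi0 hi1
    have hir : (1 : ℝ) ≤ i := by exact_mod_cast hK₀.trans hi0
    have hself : i ∈ Finset.Ico K₀ (K₁ + 1) := by rw [Finset.mem_Ico]; omega
    have hterm : 0 < Real.sqrt ((i : ℝ) / ((i : ℝ) + ((i : ℕ) : ℝ))) := Real.sqrt_pos.mpr (by positivity)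
    rw [hPh_def]; dsimp only
    exact lt_of_lt_of_le hterm
      (single_le_sum (s := Finset.Ico K₀ (K₁ + 1)) (f := fun k : ℕ => Real.sqrt ((i : ℝ) / ((i : ℝ) + (k : ℝ))))
        (fun k _ => Real.sqrt_nonneg _) hself)
  -- the summands outside the window vanish
  have hzero : ∀ i ∈ range K, i ∉ Finset.Ico K₀ (K₁ + 1) → L i / P i = 0 := by
    intro i _ hi
    rw [Finset.mem_Ico, not_and_or, not_le, not_lt] at hi
    rcases Nat.eq_zero_or_pos i with rfl | hipos
    · have hP0 : P 0 = 0 := by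
        rw [hP_def]; dsimp only
        exact sum_eq_zero fun k _ => by simp
      rw [hP0, div_zero]
    · have hLi : L i = 0 := by
        by_contra hne
        have := hwin i hipos.ne' hne
        omega
      rw [hLi, zero_div]
  have hsplit : ∑ i ∈ range K, L i / P i = ∑ i ∈ Finset.Ico K₀ (K₁ + 1), L i / P i := (sum_subset hsub hzero).symm
  -- on the window: L_i/P_i ≤ 1/P̂_i
  have hwin_le : ∀ i ∈ Finset.Ico K₀ (K₁ + 1), L i / P i ≤ 1 / Ph i := by
    intro i hi
    rw [Finset.mem_Ico] at hi
    have hPh0 := hPhpos i hi.1 (by omega)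
    rw [hunif i hi.1 (by omega)]
    calc c / P i ≤ c / (c * Ph i) := div_le_div_of_nonneg_left hc.le (mul_pos hc hPh0) (hPge i)
      _ = 1 / Ph i := by rw [div_mul_eq_div_div, div_self hc.ne']
  -- reindex the window sums over `range n`
  have hreidx : ∑ i ∈ Finset.Ico K₀ (K₁ + 1), 1 / Ph i =
      ∑ s ∈ range n, 1 / ∑ t ∈ range n, Real.sqrt (((K₀ + s : ℕ) : ℝ) / (((K₀ + s : ℕ) : ℝ) + ((K₀ + t : ℕ) : ℝ))) := by
    rw [sum_Ico_eq_sum_range, show K₁ + 1 - K₀ = n from rfl]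
    refine sum_congr rfl fun s _ => ?_
    rw [hPh_def]; dsimp only
    rw [sum_Ico_eq_sum_range, show K₁ + 1 - K₀ = n from rfl]
  change ∑ i ∈ range K, L i / P i ≤ 2
  rw [hsplit]
  calc ∑ i ∈ Finset.Ico K₀ (K₁ + 1), L i / P i ≤ ∑ i ∈ Finset.Ico K₀ (K₁ + 1), 1 / Ph i := sum_le_sum hwin_le
    _ = _ := hreidx
    _ ≤ 2 := inv_profile_sum_le_two hK₀ hn1

end Summit.QuantumFields.BalabanUV.Beta.EriceRemainderEnclosureHistoryAutonomyComparisonWindow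

end
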